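import Summits.CriticalPhenomena.PercolationContinuityZ3.Theses.PercNearOneGluing
import Literature.Probability.Percolation.PercolationEvents
import Literature.Probability.LatticeModels.ProdBernoulliIndependence
import HarnessLib

/-! # Crux `PercNearOneGluing.AdditiveGluing` (stmt-CriticalPhenomena-4576), line `starglue` — stub `stub_sureStar_sg`

Support file (`--supports stmt-CriticalPhenomena-4576`); no definitions, no named facts.  Proves exactly
the registered stub `stub_sureStar_sg` of the skeleton `Cruxes/AdditiveGluing/Lines/starglue.lean`:
the additive Conjecture 1 inequality `P(o ↔ A) − (1 − t) ≤ P(o ↔ b)` (with `t ≤ P(a ↔ b)` for every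
relay `a ∈ A`, `A` nonempty) at an observer `o`, GIVEN the same inequality for every observer `o'`
that has a fractional pair (`0 < w s(o', y) < 1` for some `y ≠ o'`).

## Proof

Let `B₀ = {x | P(o ↔ x) = 1}` (the sure cluster of `o`; `o ∈ B₀`).  For `x ∈ B₀` the events
`{o ↔ z}` / `{x ↔ z}` and `{o ↔ A}` / `{x ↔ A}` agree on the probability-one event `{o ↔ x}`, so
they have the same probability (`sureStar_real_congr_of_sure`).
* If some `o' ∈ B₀` has a fractional pair, apply the hypothesis at `o'` and transfer both sides.
* Otherwise every `u ∈ B₀` has only weight-`0`/`1` pairs, and a weight-`1` pair `s(u, z)` is open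
  a.s., forcing `z ∈ B₀`; so every pair leaving `B₀` has weight `0`.  An open path from `o` to
  `x ∉ B₀` uses a pair leaving `B₀` (`SimpleGraph.Walk.exists_boundary_dart`), and the weight-`0`
  pairs are a.s. all closed (union bound `prodBernoulli_real_exists_mem_le_sum`), so `P(o ↔ x) = 0`
  for `x ∉ B₀`.  The inequality is then a case check: `b ∈ B₀` gives right side `1`; `b ∉ B₀` and a
  relay `a ∈ A ∩ B₀` gives `t ≤ P(a ↔ b) = P(o ↔ b) = 0`; `b ∉ B₀`, `A ∩ B₀ = ∅` gives
  `P(o ↔ A) = 0` and `t ≤ 1`.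
[folklore]
-/

namespace Summit.CriticalPhenomena.PercolationContinuityZ3.Theorems

open MeasureTheory Set Literature.Probability.LatticeModels Literature.Probability.Percolation
open scoped Classical BigOperators

noncomputable section

/-- **Transfer along a sure event.**  For a probability measure, two events that agree on an event
of probability `1` have the same probability. [folklore] -/
theorem sureStar_real_congr_of_sure {α : Type*} [MeasurableSpace α] {μ : Measure α}
    [IsProbabilityMeasure μ] {N E F : Set α} (hNm : MeasurableSet N) (hN : μ.real N = 1)
    (h : ∀ x ∈ N, x ∈ E ↔ x ∈ F) : μ.real E = μ.real F := by
  have hNc : μ.real Nᶜ = 0 := by rw [probReal_compl_eq_one_sub hNm, hN, sub_self]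
  have key : ∀ {E' F' : Set α}, (∀ x ∈ N, x ∈ E' → x ∈ F') → μ.real E' ≤ μ.real F' := by
    intro E' F' hEF
    calc μ.real E' ≤ μ.real (F' ∪ Nᶜ) := by
          refine measureReal_mono (fun x hx => ?_) (measure_ne_top _ _)
          by_cases hxN : x ∈ N
          · exact Or.inl (hEF x hxN hx)
          · exact Or.inr hxN
      _ ≤ μ.real F' + μ.real Nᶜ := measureReal_union_le _ _
      _ = μ.real F' := by rw [hNc, add_zero]
  exact le_antisymm (key fun x hx => (h x hx).1) (key fun x hx => (h x hx).2)

/-- **Registered stub `stub_sureStar_sg`** (line `starglue`, sure/absent star): if the additive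
Conjecture 1 inequality `P(o' ↔ A) − (1 − t) ≤ P(o' ↔ b)` (same `w, A, b, t`, `A` nonempty,
`t ≤ P(a ↔ b)` on `A`) holds for every observer `o'` with a fractional pair, it holds at `o`.
Sure-cluster transfer (`B₀ = {x | P(o ↔ x) = 1}`): either some `o' ∈ B₀` has a fractional pair
(transfer), or the open cluster of `o` is a.s. exactly `B₀` (case check). [folklore] -/
theorem stub_sureStar_sg : ∀ (n : ℕ) (w : Sym2 (Fin n) → unitInterval) (A : Finset (Fin n)) (o b : Fin n) (t : ℝ),
    A.Nonempty → (∀ a ∈ A, t ≤ (prodBernoulli w).real (openConn a b)) →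
    (∀ y : Fin n, y ≠ o → (w s(o, y) : ℝ) = 0 ∨ (w s(o, y) : ℝ) = 1) →
    (∀ o' : Fin n, (∃ y : Fin n, y ≠ o' ∧ 0 < (w s(o', y) : ℝ) ∧ (w s(o', y) : ℝ) < 1) →
      (prodBernoulli w).real (⋃ a ∈ A, openConn o' a) - (1 - t) ≤ (prodBernoulli w).real (openConn o' b)) →
    (prodBernoulli w).real (⋃ a ∈ A, openConn o a) - (1 - t) ≤ (prodBernoulli w).real (openConn o b) := by
  intro n w A o b t hA ht _hsure hfrac
  obtain ⟨a₁, ha₁⟩ := hA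
  have ht1 : t ≤ 1 := (ht a₁ ha₁).trans measureReal_le_one
  have hU1 : (prodBernoulli w).real (⋃ a ∈ A, openConn o a) ≤ 1 := measureReal_le_one
  -- transfer of `{· ↔ z}` and `{· ↔ A}` along a sure connection `P(x ↔ x') = 1`
  have htrans : ∀ x x' z : Fin n, (prodBernoulli w).real (openConn x x') = 1 →
      (prodBernoulli w).real (openConn x z) = (prodBernoulli w).real (openConn x' z) := by
    intro x x' z hxx'
    refine sureStar_real_congr_of_sure MeasurableSet.of_discrete hxx' fun ω hω => ?_
    exact ⟨fun h => (SimpleGraph.Reachable.symm hω).trans h, fun h => SimpleGraph.Reachable.trans hω h⟩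
  have htransA : ∀ x x' : Fin n, (prodBernoulli w).real (openConn x x') = 1 →
      (prodBernoulli w).real (⋃ a ∈ A, openConn x a) =
        (prodBernoulli w).real (⋃ a ∈ A, openConn x' a) := by
    intro x x' hxx'
    refine sureStar_real_congr_of_sure MeasurableSet.of_discrete hxx' fun ω hω => ?_
    simp only [Set.mem_iUnion₂]
    refine ⟨fun ⟨a, ha, h⟩ => ⟨a, ha, ?_⟩, fun ⟨a, ha, h⟩ => ⟨a, ha, ?_⟩⟩
    · exact (SimpleGraph.Reachable.symm hω).trans h
    · exact SimpleGraph.Reachable.trans hω h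
  -- `P(x ↔ x) = 1`
  have hrefl : ∀ x : Fin n, (prodBernoulli w).real (openConn x x) = 1 := by
    intro x
    have huniv : (openConn x x : Set (BondConfig (Fin n))) = Set.univ :=
      Set.eq_univ_of_forall fun ω => SimpleGraph.Reachable.refl x
    rw [huniv]
    exact probReal_univ
  by_cases hcase : ∃ o' : Fin n, (prodBernoulli w).real (openConn o o') = 1 ∧
      ∃ y : Fin n, y ≠ o' ∧ 0 < (w s(o', y) : ℝ) ∧ (w s(o', y) : ℝ) < 1
  · -- case (a): a sure neighbour `o'` of `o` has a fractional pair
    obtain ⟨o', ho', hy⟩ := hcase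
    rw [htransA o o' ho', htrans o o' b ho']
    exact hfrac o' hy
  · -- case (b): no vertex of the sure cluster `B₀` has a fractional pair
    push Not at hcase
    -- every pair leaving `B₀` has weight `0`
    have hexit : ∀ u z : Fin n, (prodBernoulli w).real (openConn o u) = 1 →
        ¬ (prodBernoulli w).real (openConn o z) = 1 → (w s(u, z) : ℝ) = 0 := by
      intro u z hu hz
      have huz : u ≠ z := fun h => hz (h ▸ hu)
      rcases (unitInterval.nonneg (w s(u, z))).eq_or_lt with h0 | hpos
      · exact h0.symm
      · exfalso
        have h1 : (w s(u, z) : ℝ) = 1 :=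
          le_antisymm (unitInterval.le_one (w s(u, z))) (hcase u hu z huz.symm hpos)
        apply hz
        rw [← hu]
        symm
        refine sureStar_real_congr_of_sure (N := {ω : BondConfig (Fin n) | s(u, z) ∈ ω})
          MeasurableSet.of_discrete ?_ fun ω hω => ?_
        · rw [prodBernoulli_real_setOf_mem]
          exact h1
        · have hadj : (openGraph ω).Adj u z := (openGraph_adj ω u z).2 ⟨hω, huz⟩
          exact ⟨fun h => SimpleGraph.Reachable.trans h hadj.reachable,
            fun h => SimpleGraph.Reachable.trans h hadj.reachable.symm⟩
    -- hence `P(o ↔ x) = 0` off `B₀`: an open path to `x` uses a weight-`0` pair, a.s. closed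
    have hdich : ∀ x : Fin n, ¬ (prodBernoulli w).real (openConn o x) = 1 →
        (prodBernoulli w).real (openConn o x) = 0 := by
      intro x hx
      refine le_antisymm ?_ measureReal_nonneg
      calc (prodBernoulli w).real (openConn o x)
          ≤ (prodBernoulli w).real {ω : BondConfig (Fin n) |
              ∃ e ∈ (Finset.univ.filter fun e : Sym2 (Fin n) => (w e : ℝ) = 0), e ∈ ω} := by
            refine measureReal_mono (fun ω hω => ?_) (measure_ne_top _ _)
            obtain ⟨p⟩ := (hω : (openGraph ω).Reachable o x)
            obtain ⟨d, -, hd1, hd2⟩ := p.exists_boundary_dart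
              {u : Fin n | (prodBernoulli w).real (openConn o u) = 1} (hrefl o) hx
            refine ⟨s(d.fst, d.snd), Finset.mem_filter.2 ⟨Finset.mem_univ _, hexit _ _ hd1 hd2⟩, ?_⟩
            exact ((openGraph_adj ω _ _).1 d.adj).1
        _ ≤ ∑ e ∈ (Finset.univ.filter fun e : Sym2 (Fin n) => (w e : ℝ) = 0), (w e : ℝ) :=
            prodBernoulli_real_exists_mem_le_sum w _
        _ = 0 := Finset.sum_eq_zero fun e he => (Finset.mem_filter.1 he).2
    by_cases hb : (prodBernoulli w).real (openConn o b) = 1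
    · -- `b ∈ B₀`: the right side is `1`
      rw [hb]
      linarith [ht a₁ ha₁, (measureReal_le_one : (prodBernoulli w).real (openConn a₁ b) ≤ 1)]
    · have hb0 : (prodBernoulli w).real (openConn o b) = 0 := hdich b hb
      rw [hb0]
      by_cases hAa : ∃ a ∈ A, (prodBernoulli w).real (openConn o a) = 1
      · -- a sure relay `a ∈ A ∩ B₀`: `t ≤ P(a ↔ b) = P(o ↔ b) = 0`
        obtain ⟨a, ha, hPa⟩ := hAa
        have hab : (prodBernoulli w).real (openConn a b) = 0 := by
          rw [← htrans o a b hPa, hb0]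
        linarith [ht a ha]
      · -- no sure relay: `P(o ↔ A) = 0`
        push Not at hAa
        have hU0 : (prodBernoulli w).real (⋃ a ∈ A, openConn o a) ≤ 0 :=
          calc (prodBernoulli w).real (⋃ a ∈ A, openConn o a)
              ≤ ∑ a ∈ A, (prodBernoulli w).real (openConn o a) := measureReal_biUnion_finset_le _ _
            _ = 0 := Finset.sum_eq_zero fun a ha => hdich a (hAa a ha)
        linarith

end

end Summit.CriticalPhenomena.PercolationContinuityZ3.Theorems
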